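import Literature.Analysis.FluidPDE.ClassicalSolution
import HarnessLib

/-!
# Gluing classical Navier–Stokes solutions in time across a slice with matching space–time jets

Theorems only (no definitions of `Prop` type, no named facts). Elementary real analysis used
implicitly whenever a local smooth solution on `[0, T)` is continued by a second smooth solution
on `[τ, ∞)`, `0 < τ < T`, whose derivatives of all orders in time and space agree with those of the
first at `t = τ` (e.g. Smith 2006, proof of Thm 8, p. 9 l. 760–771: «the derivatives in time and
space (including the zeroth order derivative) of this solution 𝐕 match (at t̂ = T₀/2) the
corresponding derivatives of the Heywood local solution … We call denote this matched solution of
the Navier-Stokes equations … on [0,∞) × ℝ³ by u, p»): the field `t ↦ if t < τ then u t else w t` is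
again a classical solution on `[0, ∞)`.

* (private) `hasFTaylorSeriesUpToOn_union_of_isClosed` — PASTING LEMMA for formal Taylor series: a common
  Taylor series of `f` on two CLOSED sets is a Taylor series on their union (Mathlib
  `HasFDerivWithinAt.union`, `HasFDerivWithinAt.of_notMem_closure`, `ContinuousOn.union_of_isClosed`).
* (private) `contDiffOn_union_of_hasFTaylorSeriesUpToOn` — `C^n` on the union of two closed sets from Taylor
  series on each that AGREE on the intersection.
* `isSmoothSpaceTimeOn_glue` — joint smoothness on `[0, ∞) × X` of the time-glued field from joint
  smoothness on `[0, T) × X` and `[τ, ∞) × X` plus matching `iteratedFDerivWithin` jets on `{τ} × X`.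
* `IsClassicalNSSolutionOn.glue_of_jetsMatch` — the glued pair solves the system classically on
  `[0, ∞)` (momentum at `t ≥ τ`, including `t = τ`, through the one-sided derivative within `[τ, ∞)`
  of the glued smooth field; at `t < τ` through the derivative within `[0, τ)`).

[folklore] (smooth pasting across a hyperplane from matching one-sided jets); used as printed in
[cite: Smith2006, Thm 8 proof p.9 l.760–771].
-/

noncomputable section

open Set Function
open scoped ContDiff

namespace Literature.Analysis.FluidPDE

/-! ### The pasting lemma for formal Taylor series on closed sets -/

section Pasting

variable {𝕜 : Type*} [NontriviallyNormedField 𝕜]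
variable {E : Type*} [NormedAddCommGroup E] [NormedSpace 𝕜 E]
variable {F : Type*} [NormedAddCommGroup F] [NormedSpace 𝕜 F]

/-- **Pasting lemma for Taylor series.** If `p` is a Taylor series of `f` up to order `n` within each
of two closed sets `s`, `t`, it is one within `s ∪ t`: the derivative condition at a point of `s ∪ t`
is the union of the two one-sided conditions (vacuous off the closed set not containing the point),
and continuity pastes on closed sets. [folklore] -/
private theorem hasFTaylorSeriesUpToOn_union_of_isClosed {n : WithTop ℕ∞} {f : E → F}
    {p : E → FormalMultilinearSeries 𝕜 E F} {s t : Set E}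
    (hs : HasFTaylorSeriesUpToOn n f p s) (ht : HasFTaylorSeriesUpToOn n f p t)
    (hsc : IsClosed s) (htc : IsClosed t) : HasFTaylorSeriesUpToOn n f p (s ∪ t) where
  zero_eq x hx := hx.elim (hs.zero_eq x) (ht.zero_eq x)
  fderivWithin m hm x _ := by
    refine HasFDerivWithinAt.union ?_ ?_
    · by_cases hxs : x ∈ s
      · exact hs.fderivWithin m hm x hxs
      · exact HasFDerivWithinAt.of_notMem_closure (by rwa [hsc.closure_eq])
    · by_cases hxt : x ∈ t
      · exact ht.fderivWithin m hm x hxt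
      · exact HasFDerivWithinAt.of_notMem_closure (by rwa [htc.closure_eq])
  cont m hm := (hs.cont m hm).union_of_isClosed (ht.cont m hm) hsc htc

/-- **`C^n` across a closed interface from matching jets.** If `f` has Taylor series `p` within a
closed set `s` and `q` within a closed set `t`, and `p = q` on `s ∩ t`, then `f` is `C^n` on
`s ∪ t`. [folklore] -/
private theorem contDiffOn_union_of_hasFTaylorSeriesUpToOn {n : ℕ∞} {f : E → F}
    {p q : E → FormalMultilinearSeries 𝕜 E F} {s t : Set E} (hsc : IsClosed s) (htc : IsClosed t)
    (hp : HasFTaylorSeriesUpToOn n f p s) (hq : HasFTaylorSeriesUpToOn n f q t)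
    (hpq : ∀ x ∈ s ∩ t, p x = q x) : ContDiffOn 𝕜 n f (s ∪ t) := by
  classical
  let P : E → FormalMultilinearSeries 𝕜 E F := fun x => if x ∈ t then q x else p x
  have hP₁ : HasFTaylorSeriesUpToOn n f P s := by
    refine hp.congr_series fun m _ x hx => ?_
    by_cases hxt : x ∈ t
    · simp only [P, if_pos hxt, hpq x ⟨hx, hxt⟩]
    · simp only [P, if_neg hxt]
  have hP₂ : HasFTaylorSeriesUpToOn n f P t :=
    hq.congr_series fun m _ x hx => by simp only [P, if_pos hx]
  exact (hasFTaylorSeriesUpToOn_union_of_isClosed hP₁ hP₂ hsc htc).contDiffOn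

end Pasting

/-! ### Time-gluing of jointly smooth fields -/

section SpaceTime

variable {X : Type*} [NormedAddCommGroup X] [NormedSpace ℝ X]
variable {F : Type*} [NormedAddCommGroup F] [NormedSpace ℝ F]

/-- **Joint smoothness of the time-glued field.** Let `a` be jointly `C^∞` on `[0, T) × X` and `b`
on `[τ, ∞) × X`, `0 ≤ τ < T`, and let all space–time derivatives (within the respective slabs) of
`b` and `a` agree on the slice `{τ} × X`. Then `t ↦ if t < τ then a t else b t` is jointly `C^∞` on
`[0, ∞) × X` (pasting on the closed slabs `[0, τ] × X` and `[τ, ∞) × X`) — the sentence «the derivatives in time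
and space (including the zeroth order derivative) … match … this matched solution … on [0,∞) × ℝ³» of
the cited proof, for one field. [cite: Smith2006, Thm 8 proof p.9 l.760–771] -/
theorem isSmoothSpaceTimeOn_glue {τ T : ℝ} (h0τ : 0 ≤ τ) (hτT : τ < T) {a b : ℝ → X → F}
    (ha : IsSmoothSpaceTimeOn (Ico 0 T) a) (hb : IsSmoothSpaceTimeOn (Ici τ) b)
    (hj : ∀ (n : ℕ) (x : X), iteratedFDerivWithin ℝ n (uncurry b) (Ici τ ×ˢ univ) (τ, x) =
      iteratedFDerivWithin ℝ n (uncurry a) (Ico 0 T ×ˢ univ) (τ, x)) :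
    IsSmoothSpaceTimeOn (Ici 0) (fun t => if t < τ then a t else b t) := by
  -- the two closed slabs and the ambient slab of `a`
  have hS₁A : (Icc 0 τ ×ˢ (univ : Set X)) ⊆ Ico 0 T ×ˢ univ :=
    prod_mono (Icc_subset_Ico_right hτT) Subset.rfl
  have hUA : UniqueDiffOn ℝ (Ico 0 T ×ˢ (univ : Set X)) :=
    (uniqueDiffOn_Ico 0 T).prod uniqueDiffOn_univ
  have hU₂ : UniqueDiffOn ℝ (Ici τ ×ˢ (univ : Set X)) := (uniqueDiffOn_Ici τ).prod uniqueDiffOn_univ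
  -- Taylor series of the two pieces
  have hpa : HasFTaylorSeriesUpToOn ∞ (uncurry a) (ftaylorSeriesWithin ℝ (uncurry a) (Ico 0 T ×ˢ univ))
      (Icc 0 τ ×ˢ (univ : Set X)) :=
    (ContDiffOn.ftaylorSeriesWithin ha hUA).mono hS₁A
  have hqb : HasFTaylorSeriesUpToOn ∞ (uncurry b) (ftaylorSeriesWithin ℝ (uncurry b) (Ici τ ×ˢ univ))
      (Ici τ ×ˢ (univ : Set X)) :=
    ContDiffOn.ftaylorSeriesWithin hb hU₂
  -- order zero of the matching: the values agree on the slice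
  have hval : ∀ x : X, b τ x = a τ x := by
    intro x
    have h0 := congrArg (fun L : (ℝ × X)[×0]→L[ℝ] F => L 0) (hj 0 x)
    simpa only [iteratedFDerivWithin_zero_apply, Function.uncurry_apply_pair] using h0
  -- the glued field agrees with `a` on the first slab and with `b` on the second
  have hGa : ∀ z ∈ Icc 0 τ ×ˢ (univ : Set X),
      uncurry (fun t => if t < τ then a t else b t) z = uncurry a z := by
    rintro ⟨t, x⟩ ⟨⟨-, htτ⟩, -⟩
    rcases htτ.lt_or_eq with hlt | heq
    · simp [hlt]
    · subst heq
      simp [hval x]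
  have hGb : ∀ z ∈ Ici τ ×ˢ (univ : Set X),
      uncurry (fun t => if t < τ then a t else b t) z = uncurry b z := by
    rintro ⟨t, x⟩ ⟨hτt, -⟩
    simp [not_lt.2 (mem_Ici.1 hτt)]
  -- the two series agree on the interface `{τ} × X`
  have hpq : ∀ z ∈ (Icc 0 τ ×ˢ (univ : Set X)) ∩ (Ici τ ×ˢ univ),
      ftaylorSeriesWithin ℝ (uncurry a) (Ico 0 T ×ˢ univ) z =
        ftaylorSeriesWithin ℝ (uncurry b) (Ici τ ×ˢ univ) z := by
    rintro ⟨t, x⟩ ⟨⟨⟨-, htτ⟩, -⟩, ⟨hτt, -⟩⟩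
    obtain rfl : t = τ := le_antisymm htτ hτt
    funext n
    exact (hj n x).symm
  have h12 := contDiffOn_union_of_hasFTaylorSeriesUpToOn (isClosed_Icc.prod isClosed_univ)
    (isClosed_Ici.prod isClosed_univ) (hpa.congr hGa) (hqb.congr hGb) hpq
  -- the union of the slabs is `[0, ∞) × X`
  unfold IsSmoothSpaceTimeOn
  rw [← Icc_union_Ici_eq_Ici h0τ, union_prod]
  exact h12

end SpaceTime

/-! ### Gluing classical solutions -/

section Classical

variable {E : Type*} [NormedAddCommGroup E] [InnerProductSpace ℝ E] [FiniteDimensional ℝ E]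
variable {ν : ℝ} {f : ℝ → E → E}

/-- **Time-gluing of classical solutions with matching jets.** Let `(u, p)` be a classical solution
on `[0, T) × E` and `(w, q)` one on `[τ, ∞) × E` of the same system (`ν`, `f`), `0 < τ < T`, and let
ALL space–time derivatives of `w` and `u`, and of `q` and `p`, within their slabs agree on the slice
`t = τ`. Then `t ↦ if t < τ then u t else w t` (with the pressures glued likewise) is a classical
solution on `[0, ∞) × E`: joint smoothness by pasting (`isSmoothSpaceTimeOn_glue`); the momentum
equation at `t < τ` is that of `u` (the one-sided time derivative within `[0, ∞)` equals the one
within `[0, τ)`, where the glued field is `u`), and at `t ≥ τ` — the slice `t = τ` included — that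
of `w` (the derivative within `[0, ∞)` of the glued smooth field equals its derivative within
`[τ, ∞)`, where the field is `w`). [folklore] [cite: Smith2006, Thm 8 proof p.9 l.760–771] -/
theorem IsClassicalNSSolutionOn.glue_of_jetsMatch {τ T : ℝ} (h0τ : 0 < τ) (hτT : τ < T)
    {u w : ℝ → E → E} {p q : ℝ → E → ℝ}
    (hu : IsClassicalNSSolutionOn (Ico 0 T) ν f u p) (hw : IsClassicalNSSolutionOn (Ici τ) ν f w q)
    (hju : ∀ (n : ℕ) (x : E), iteratedFDerivWithin ℝ n (uncurry w) (Ici τ ×ˢ univ) (τ, x) =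
      iteratedFDerivWithin ℝ n (uncurry u) (Ico 0 T ×ˢ univ) (τ, x))
    (hjp : ∀ (n : ℕ) (x : E), iteratedFDerivWithin ℝ n (uncurry q) (Ici τ ×ˢ univ) (τ, x) =
      iteratedFDerivWithin ℝ n (uncurry p) (Ico 0 T ×ˢ univ) (τ, x)) :
    IsClassicalNSSolutionOn (Ici 0) ν f (fun t => if t < τ then u t else w t)
      (fun t => if t < τ then p t else q t) := by
  have hU : IsSmoothSpaceTimeOn (Ici 0) (fun t => if t < τ then u t else w t) :=
    isSmoothSpaceTimeOn_glue h0τ.le hτT hu.smooth_velocity hw.smooth_velocity hju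
  have hP : IsSmoothSpaceTimeOn (Ici 0) (fun t => if t < τ then p t else q t) :=
    isSmoothSpaceTimeOn_glue h0τ.le hτT hu.smooth_pressure hw.smooth_pressure hjp
  refine ⟨hU, hP, fun t ht x => ?_, fun t ht => ?_⟩
  · by_cases htτ : t < τ
    · -- before the slice: the glued field is `u` near `t` within `[0, τ)`
      have htI : t ∈ Ico 0 τ := ⟨ht, htτ⟩
      have e1 : timeDerivWithin (Ici 0) (fun t => if t < τ then u t else w t) t x =
          timeDerivWithin (Ico 0 T) u t x := by
        rw [← hU.timeDerivWithin_eq_of_subset Ico_subset_Ici_self (uniqueDiffOn_Ico 0 τ) htI x,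
          ← hu.smooth_velocity.timeDerivWithin_eq_of_subset (Ico_subset_Ico_right hτT.le)
            (uniqueDiffOn_Ico 0 τ) htI x]
        simp only [timeDerivWithin_apply]
        exact derivWithin_congr (fun s hs => by simp [hs.2]) (by simp [htτ])
      rw [e1]
      simp only [if_pos htτ]
      exact hu.momentum t ⟨ht, htτ.trans hτT⟩ x
    · -- on and after the slice: the glued field is `w` on `[τ, ∞)`
      have htI : t ∈ Ici τ := not_lt.1 htτ
      have e1 : timeDerivWithin (Ici 0) (fun t => if t < τ then u t else w t) t x =
          timeDerivWithin (Ici τ) w t x := by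
        rw [← hU.timeDerivWithin_eq_of_subset (Ici_subset_Ici.2 h0τ.le) (uniqueDiffOn_Ici τ) htI x]
        simp only [timeDerivWithin_apply]
        exact derivWithin_congr (fun s hs => by simp [not_lt.2 (mem_Ici.1 hs)]) (by simp [htτ])
      rw [e1]
      simp only [if_neg htτ]
      exact hw.momentum t htI x
  · by_cases htτ : t < τ
    · simp only [if_pos htτ]
      exact hu.divFree t ⟨ht, htτ.trans hτT⟩
    · simp only [if_neg htτ]
      exact hw.divFree t (not_lt.1 htτ)

end Classical

end Literature.Analysis.FluidPDE

end

-- WHAT THIS IS NOT: not a claim about NS regularity or blow-up; not a claim about any author beyond the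
-- typed locator.
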